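import Summits.RiemannHypothesis.RiemannHypothesis.Theorems.PfPersistenceTallyAccumulation
import Summits.RiemannHypothesis.RiemannHypothesis.Theorems.PfPersistenceGalerkinTestSupDensity
import HarnessLib

/-!
# PF persistence — W2 ON THE TALLY DOMAIN, UNCONDITIONAL (the sup density is PROVED: cand-3's Fejér profiles)
(pub-rhpf barrier-typer gen 5, part 3; CLASS.md §4.3 W2, CASE-DAG B-W2; lead g9 14:15:32Z re-point ask)

**HONEST FRAMING. This is a long-odds MECHANISM SEARCH; no RH claims.** RH-free. Part 2
(`PfPersistenceTallyAccumulation`) proved the `DialReady`-free wall W2 on the tally modulo ONE typed input, the sup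
form `TestToProfileSupDensity` of the GAL-1 density. cand-3 g6 has meanwhile PROVED the C^{0,1} density of cut-off
cosine profiles (`exists_cutoffProfile_near`: Fejér means, uniform on `ℝ` with a Lipschitz bound) and the continuity
of mass and Markov closed form along such sequences (`tendsto_markovClosedForm`), whence (ii‴)/(ii″)
(`testToClosedFormDensity`, `testToGalerkinFormDensity`, tree 8bfafb17c1e9) AND the sup form itself
(`testToProfileSupDensity : TestToProfileSupDensity`, `PfPersistenceGalerkinTestSupDensity`, tree 1dbb0c47e4de). Fed by name,
every statement of part 2 now holds WITH NO TYPED INPUT (deprecate-and-add: new names, part-2 decls kept):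

* `tally_negativesAccumulateNe_of_weilPositivity` — window positivity of `ζ` ⇒ the detectably negative arithmetic
  data `≠ ζ` accumulate at `ζ` uniformly (`τ_unif`); `tally_negativesAccumulateNe_of_riemannHypothesis` (RH as an
  explicit hypothesis; no RH claim).
* `tally_not_riemannHypothesis_or_negativesAccumulateNe` — RH-FREE DICHOTOMY: `ζ`'s datum is detectably negative
  (and RH fails) OR the arithmetic negatives accumulate at `ζ`.
* `tally_not_separates_of_uniformlyRobust` — **W2 (tally), UNCONDITIONAL:** no criterion `τ_unif`-robust at `ζ`
  separates `ζ` from the detectably negative members of any domain `D ⊇ arithDialSpace`; in particular not on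
  `arithDialSpace` and not on `dialSpace` (`tally_wall`); with W1 (`not_separates_of_finitelyDetermined`):
  `two_walls` — on `D ⊇ dialSpace` no finitely determined OR `τ_unif`-robust criterion separates (RH-free, input-free).

References: E. Bombieri, Rend. Mat. Acc. Lincei (9) 11 (2000) §4; the cell files cited by name above.
-/

set_option linter.dupNamespace false

noncomputable section

open Real MeasureTheory Set Filter
open _root_.Literature.NumberTheory.LFunctions

namespace Summit.RiemannHypothesis.RiemannHypothesis.Theorems.PfPersistence

/-- **PROVED (conditional on window positivity of `ζ` only; no RH claim):** if `ζ` is Weil-positive on every window,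
the detectably negative ARITHMETIC data other than `ζ` accumulate at `ζ` uniformly. [folklore] -/
theorem tally_negativesAccumulateNe_of_weilPositivity (hW : ∀ a : ℝ, 0 < a → WeilPositivityOn a) :
    NegativesAccumulateNe arithDialSpace zetaDatum :=
  negativesAccumulateNe_arithDialSpace_of_weilPositivity testToProfileSupDensity hW

/-- **PROVED — CONDITIONAL COROLLARY (RH as an explicit hypothesis; no RH claim).** [folklore] -/
theorem tally_negativesAccumulateNe_of_riemannHypothesis (hRH : RiemannHypothesis) :
    NegativesAccumulateNe arithDialSpace zetaDatum :=
  negativesAccumulateNe_arithDialSpace_of_riemannHypothesis testToProfileSupDensity hRH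

/-- **PROVED — RH-FREE DICHOTOMY, UNCONDITIONAL:** either `ζ`'s own datum is detectably negative (and RH fails), or
the detectably negative arithmetic data `≠ ζ` accumulate at `ζ` uniformly. [folklore] -/
theorem tally_not_riemannHypothesis_or_negativesAccumulateNe :
    (¬ RiemannHypothesis ∧ DetectablyNegative zetaDatum) ∨ NegativesAccumulateNe arithDialSpace zetaDatum :=
  not_riemannHypothesis_or_negativesAccumulateNe_arithDialSpace testToProfileSupDensity

/-- **PROVED — W2 ON THE TALLY DOMAIN, UNCONDITIONAL (RH-free, no typed input):** no criterion `τ_unif`-robust at `ζ`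
separates `ζ` from the detectably negative members of any domain containing the arithmetic dial space. [folklore] -/
theorem tally_not_separates_of_uniformlyRobust {S D : Set Datum} (hDs : arithDialSpace ⊆ D)
    (hS : UniformlyRobustAt S zetaDatum) : ¬ Separates S D zetaDatum :=
  not_separates_of_uniformlyRobust_tally testToProfileSupDensity hDs hS

/-- **PROVED — the wall at the two domains of record, UNCONDITIONAL.** [folklore] -/
theorem tally_wall {S : Set Datum} (hS : UniformlyRobustAt S zetaDatum) :
    ¬ Separates S arithDialSpace zetaDatum ∧ ¬ Separates S dialSpace zetaDatum :=
  not_separates_arith_of_uniformlyRobust testToProfileSupDensity hS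

/-- **PROVED — THE TWO WALLS, UNCONDITIONAL (CLASS.md §4.3; the barrier theorem of record at gen 5).** On any domain
containing Bombieri's dial space, NO criterion that is finitely determined (W1, locality) OR `τ_unif`-robust at `ζ`
(W2, tally) separates `ζ` from the detectably negative members. RH-free, no typed input; no RH claim either way —
the admissible class `𝒞` of CLASS.md §2 lies inside `W1 ∪ W2` row by row (MEMBERSHIP.md), which is where the
case analysis, not this theorem, carries the "every 𝒞ᵢ fails" reading. [folklore] -/
theorem two_walls {S D : Set Datum} (hD : dialSpace ⊆ D)
    (hS : FinitelyDetermined S ∨ UniformlyRobustAt S zetaDatum) : ¬ Separates S D zetaDatum :=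
  hS.elim (not_separates_of_finitelyDetermined hD)
    (tally_not_separates_of_uniformlyRobust (arithDialSpace_subset_dialSpace.trans hD))

end Summit.RiemannHypothesis.RiemannHypothesis.Theorems.PfPersistence

end
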